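import Summits.Langlands.Langlands.Theses.EvenSkinnerWilesMirror
import Summits.Langlands.Langlands.Theses.SkinnerWilesDefectOne
import Summits.Langlands.Langlands.Theorems.SkinnerWilesDefectOneModularOfProModularClassical

/-!
# Crux `ReducibleOrdinaryModular` (stmt-Langlands-12918), route `EvenSkinnerWilesMirror` —
# REDIRECT STRATEGIST r1: logical position of the crux and of the route's restated junction

Seat `planner-cstrat-stmt-Langlands-12918-r1-0`, 2026-08-17.  Evidence file (not a Theorems
proposal): every theorem below is sorry-free and asserts NO open statement — open items appear only
as hypotheses, inside `↔`, or under `¬`.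

§1  `crux_of_langlands_of_deRham` — **S ⇒ C modulo one printed fact.**  `Langlands →
    OrientedOrdinaryIsDeRham → ReducibleOrdinaryModular`: the crux is the (B)-direction of the summit
    for `n = 2` over an imaginary quadratic field, restricted to the residually reducible
    SW-oriented ordinary sector, with the Satake-only conclusion; the only input the tree lacks is
    "ordinary of weight `k ≥ 2` (diagonal characters algebraic on an OPEN subgroup of inertia) ⇒ de
    Rham for the PINNED Fontaine datum" (Gee–Geraghty 2012 Lemma 3.1.4 (1): ordinary ⇒ potentially
    semistable; Berger 2002 Thm 0.7 / Fontaine 1994 Exp. VIII: pst ⇔ de Rham), stated here as the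
    hypothesis `OrientedOrdinaryIsDeRham` (a `Prop`, not asserted; the tree vendors only part (3) of
    that lemma, `GeeGeraghty2012.crystalline_of_ordinary_regular`, which needs the diagonal
    characters algebraic on ALL of inertia).  So C is a CONSEQUENCE of S (given a theorem in print),
    never the summit in costume: the converse `C → S` has no proof term here or anywhere in the tree
    (probes `bc/ReducibleOrdinaryModular_probe_CS*.lean`, rc 1; `#h21_crux_probe` VERDICT CLEAN).
§2  `crux_of_engine_of_exit` — the REGISTERED decomposition of the crux (line `birth`, = the parent
    route's seam), re-run against THIS route's copy of the shared decl: engine (stmt-Langlands-12919)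
    → exit (stmt-Langlands-12921) → C, by the LANDED assembly `ModularOfProModularClassical`
    (stmt-Langlands-14468, proved) and `Iff.rfl` between the copies.
§3  The route's junction `SectorComplement := NoEvenReducibleOrdinary → Langlands`
    (stmt-Langlands-15312, the item the gate flagged `restated`): `Langlands → SectorComplement`;
    under the target, and under the route's other four cruxes, `SectorComplement ↔ Langlands`;
    `¬ SectorComplement ↔ NoEvenReducibleOrdinary ∧ ¬ Langlands`.  (The theorem the gate's flag cites,
    `Theorems.SectorComplement.Negative.sectorComplement_iff_langlands`, concerns the homonymous
    decl of route `RepeatedRootSocle`; these are the corresponding facts for THIS route's decl.)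
-/

set_option linter.dupNamespace false

namespace Summit.Langlands.Langlands.Cruxes.ReducibleOrdinaryModular.StrategistR1

open Filter IsDedekindDomain NumberField
open Summit.Langlands.Langlands.Theses
open Summit.Langlands.Langlands.Theses.EvenSkinnerWilesMirror

/-! ### §0 The three copies of the shared item are one term -/

theorem crux_iff_parent :
    EvenSkinnerWilesMirror.ReducibleOrdinaryModular ↔ SkinnerWilesDefectOne.ReducibleOrdinaryModular :=
  Iff.rfl

/-! ### §1 S ⇒ C modulo "oriented ordinary ⇒ de Rham (pinned Fontaine datum)" -/

/-- The printed fact the tree lacks, as a hypothesis (NOT asserted): for a framed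
`ρ : Γ_F →ₜ* GL₂(ℚ̄_p)` over a number field `F` carrying, at every `v ∣ p`, an ordinary frame of some
weight `k ≥ 2` and exponent `m ≥ 1` (lower-left zero; on inertia `θ₂^m = 1`, `θ₁^m = ε^{(k-1)m}` — the
un-oriented, un-distinguished core of the crux's local clause), `ρ|_{Γ_{F_v}}` is de Rham for the
pinned datum `fontainePstAdicCompletion v p hv` at every `v ∣ p`.  In print: Gee–Geraghty 2012
Lemma 3.1.4 (1) (ordinary ⇒ potentially semistable, via Nekovář 1993 Prop. 1.28) with Berger 2002
Thm 0.7 (de Rham ⇔ potentially semistable). [cite: GeeGeraghty2012, Lemma 3.1.4 (1)]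
[cite: BergerLaurent2002, Thm. 0.7] -/
def OrientedOrdinaryIsDeRham : Prop :=
  ∀ (F : Type) [Field F] [NumberField F] (p : ℕ) [Fact p.Prime]
    (ρ : Literature.NumberTheory.GaloisRepresentations.FramedGaloisRep F (PadicAlgCl p) 2),
    (∃ k : ℕ, 2 ≤ k ∧ ∃ m : ℕ, 0 < m ∧ ∀ v : HeightOneSpectrum (𝓞 F), (p : 𝓞 F) ∈ v.asIdeal →
      ∃ Q : Matrix.GeneralLinearGroup (Fin 2) (PadicAlgCl p), ∀ σ, (Q⁻¹ * ρ.toLocal v σ * Q).val 1 0 = 0 ∧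
        (σ ∈ Literature.NumberTheory.GaloisRepresentations.absInertia (v.adicCompletion F) →
          (Q⁻¹ * ρ.toLocal v σ * Q).val 1 1 ^ m = 1 ∧
          (Q⁻¹ * ρ.toLocal v σ * Q).val 0 0 ^ m = algebraMap (Padic p) (PadicAlgCl p)
            (((Literature.NumberTheory.GaloisRepresentations.GaloisRep.cyclotomicCharacter
              (v.adicCompletion F) p σ).val : PadicInt p) : Padic p) ^ ((k - 1) * m))) →
    ∀ (v : HeightOneSpectrum (𝓞 F)) (hv : ((p : ℕ) : 𝓞 F) ∈ v.asIdeal),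
      (Literature.NumberTheory.PAdicHodge.fontainePstAdicCompletion v p hv).IsDeRhamFramed (ρ.toLocal v)

/-- **S ⇒ C, kernel-checked modulo the printed de Rham fact.**  From `Langlands` at the imaginary
quadratic field `F`: reciprocity data `𝓡` exist; direction (B) for `n = 2` at `𝓡` applied to the
crux's `ρ` (irreducible by hypothesis; geometric = a.e. unramified by hypothesis + de Rham at `v ∣ p`
by `OrientedOrdinaryIsDeRham`, the pinned datum `𝓡.pst p v hv` being `fontainePstAdicCompletion v p hv`
by definition) gives an L-algebraic cuspidal `π` with `Corresponds 𝓡 ι π ρ`, whose first conjunct is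
the crux's conclusion (cofinite Satake–Frobenius compatibility). [folklore] -/
theorem crux_of_langlands_of_deRham (hS : _root_.Langlands) (hdR : OrientedOrdinaryIsDeRham) :
    EvenSkinnerWilesMirror.ReducibleOrdinaryModular := by
  intro F _ _ _hF _hdeg p _ _hp O _hO hcpt ι ρ _ρ₀ hirr hunr _hmod hloc
  obtain ⟨⟨𝓡⟩, hcorr⟩ := hS F
  have hB : Summit.Langlands.GaloisToAutomorphic 2 𝓡 hcpt := (hcorr 𝓡 2 two_pos hcpt).2
  have hcore : ∃ k : ℕ, 2 ≤ k ∧ ∃ m : ℕ, 0 < m ∧ ∀ v : HeightOneSpectrum (𝓞 F), (p : 𝓞 F) ∈ v.asIdeal →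
      ∃ Q : Matrix.GeneralLinearGroup (Fin 2) (PadicAlgCl p), ∀ σ, (Q⁻¹ * ρ.toLocal v σ * Q).val 1 0 = 0 ∧
        (σ ∈ Literature.NumberTheory.GaloisRepresentations.absInertia (v.adicCompletion F) →
          (Q⁻¹ * ρ.toLocal v σ * Q).val 1 1 ^ m = 1 ∧
          (Q⁻¹ * ρ.toLocal v σ * Q).val 0 0 ^ m = algebraMap (Padic p) (PadicAlgCl p)
            (((Literature.NumberTheory.GaloisRepresentations.GaloisRep.cyclotomicCharacter
              (v.adicCompletion F) p σ).val : PadicInt p) : Padic p) ^ ((k - 1) * m)) := by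
    obtain ⟨k, hk, m, hm, hv⟩ := hloc
    refine ⟨k, hk, m, hm, fun v hpv => ?_⟩
    obtain ⟨-, Q, -, hQ⟩ := hv v hpv
    exact ⟨Q, hQ⟩
  have hgeo : Summit.Langlands.IsGeometricFramed 𝓡 ρ :=
    ⟨hunr, fun v hv => hdR F p ρ hcore v hv⟩
  obtain ⟨π, hπL, hπc⟩ := hB p ι ρ hirr hgeo
  exact ⟨π, hπL, hπc.1⟩

/-- Hence, granted the printed de Rham fact, the crux is AT MOST the summit: `Langlands → C`.
Contrapositive bookkeeping: a refutation of the crux refutes the summit. [folklore] -/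
theorem not_langlands_of_not_crux (hdR : OrientedOrdinaryIsDeRham)
    (h : ¬ EvenSkinnerWilesMirror.ReducibleOrdinaryModular) : ¬ _root_.Langlands :=
  fun hS => h (crux_of_langlands_of_deRham hS hdR)

/-! ### §2 The registered decomposition of the crux, against THIS route's copy -/

/-- ENGINE (stmt-Langlands-12919) → EXIT (stmt-Langlands-12921) → the crux of route
`EvenSkinnerWilesMirror` BY NAME, through the LANDED assembly of route `SkinnerWilesDefectOne`
(`skinnerWilesDefectOne_modularOfProModularClassical_proof`, item stmt-Langlands-14468, proved) and
`crux_iff_parent`. [folklore] -/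
theorem crux_of_engine_of_exit (h₁ : SkinnerWilesDefectOne.ReducibleOrdinaryProModular)
    (h₂ : SkinnerWilesDefectOne.ProModularOrdinaryClassical) :
    EvenSkinnerWilesMirror.ReducibleOrdinaryModular :=
  crux_iff_parent.mpr
    (Summit.Langlands.Langlands.Theorems.skinnerWilesDefectOne_modularOfProModularClassical_proof h₁ h₂)

/-! ### §3 Position of the route's junction `SectorComplement` (stmt-Langlands-15312) -/

/-- The junction is implied by the summit (discard the sector hypothesis). [folklore] -/
theorem sectorComplement_of_langlands : _root_.Langlands → EvenSkinnerWilesMirror.SectorComplement :=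
  fun h _ => h

/-- Under the route TARGET `NoEvenReducibleOrdinary`, the junction IS the summit. [folklore] -/
theorem sectorComplement_iff_langlands_of_target (hX : NoEvenReducibleOrdinary) :
    EvenSkinnerWilesMirror.SectorComplement ↔ _root_.Langlands :=
  ⟨fun hC => hC hX, fun h _ => h⟩

/-- Under the route's other four cruxes (the remaining hypotheses of `closes`), the junction is
equivalent to the summit — `→` is the route's sorry-free `closes`. [folklore] -/
theorem sectorComplement_iff_langlands_of_cruxes (hP : BianchiMirrorParity) (hE : MirrorEntry)
    (hSW : EvenSkinnerWilesMirror.ReducibleOrdinaryModular) (hD : DeterminantParity) :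
    EvenSkinnerWilesMirror.SectorComplement ↔ _root_.Langlands :=
  ⟨fun hC => EvenSkinnerWilesMirror.closes hP hE hSW hD hC, fun h _ => h⟩

/-- Exact content of a refutation of the junction: prove the (open) even-sector theorem AND refute
the formal summit. [folklore] -/
theorem not_sectorComplement_iff :
    ¬ EvenSkinnerWilesMirror.SectorComplement ↔ NoEvenReducibleOrdinary ∧ ¬ _root_.Langlands :=
  Classical.not_imp

/-- Truth table: `SectorComplement ↔ ¬ NoEvenReducibleOrdinary ∨ Langlands`. [folklore] -/
theorem sectorComplement_iff_not_or :
    EvenSkinnerWilesMirror.SectorComplement ↔ ¬ NoEvenReducibleOrdinary ∨ _root_.Langlands :=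
  imp_iff_not_or

end Summit.Langlands.Langlands.Cruxes.ReducibleOrdinaryModular.StrategistR1
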